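import Mathlib
import HarnessLib
import Literature.Analysis.FluidPDE.SelfSimilar
import Literature.Analysis.FluidPDE.KochTataru
import Literature.Analysis.FluidPDE.MildSolution
import Literature.Analysis.FluidPDE.VectorCalculus
import Literature.Analysis.FluidPDE.WeakSolution
import Literature.Analysis.FluidPDE.AxisymmetricEuler
import Summits.NavierStokesRegularity.NavierStokesRegularity.Theses.SymmetryModuliCount

/-!
# Sketch — crux-ideate, crux `SymmetricLiouville` (stmt-NavierStokesRegularity-4053), round 1, ideator 1

First lemmas of the three idea cards, stated over existing declarations (no proofs; `def … : Prop`).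
`InA C u` below is VERBATIM the hypothesis block of the crux decl
`Summit.NavierStokesRegularity.NavierStokesRegularity.Theses.SymmetryModuliCount.SymmetricLiouville`
(the class 𝒜_C: smooth on t<0, divergence free, KNSS Oseen-mild, Type-I time decay with constant C).
-/

noncomputable section

namespace Summit.NavierStokesRegularity.NavierStokesRegularity.Cruxes.SymmetricLiouville.SketchIdeator1

open MeasureTheory Set

local notation "ℝ³" => EuclideanSpace ℝ (Fin 3)

/-- The class 𝒜_C of the crux, verbatim (hypothesis block of `SymmetricLiouville`). -/
def InA (C : ℝ) (u : ℝ → ℝ³ → ℝ³) : Prop :=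
  ContDiffOn ℝ (⊤ : ℕ∞) (Function.uncurry u) (Set.Iio 0 ×ˢ Set.univ) ∧
  (∀ t < 0, Literature.Analysis.FluidPDE.VectorCalculus.IsDivFree (u t)) ∧
  (∀ s t : ℝ, s < t → t < 0 → ∀ x, u t x = Literature.Analysis.FluidPDE.heatFlow (u s) (t - s) x -
     ∫ τ in Set.Ioo s t, ∫ y, Literature.Analysis.FluidPDE.oseenKernel (t - τ) (x - y) (u τ y) (u τ y)) ∧
  Literature.Analysis.FluidPDE.HasTypeITimeDecay C u

/-- Sanity: `InA` is literally the crux's hypothesis, so the crux reads `InA C u → (symmetry) → u ≡ 0`. -/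
theorem symmetricLiouville_iff :
    Summit.NavierStokesRegularity.NavierStokesRegularity.Theses.SymmetryModuliCount.SymmetricLiouville ↔
    ∀ (C : ℝ) (u : ℝ → ℝ³ → ℝ³), InA C u →
      ∀ (a : ℝ³) (σ : ℝ) (A : ℝ³ →L[ℝ] ℝ³), (∀ x, inner ℝ (A x) x = 0) → ¬ (a = 0 ∧ σ = 0 ∧ A = 0) →
        (∀ t < 0, ∀ x, fderiv ℝ (u t) x (a + σ • x + A x) + σ • u t x +
          (2 * σ * t) • Literature.Analysis.FluidPDE.timeDeriv u t x - A (u t x) = 0) →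
        ∀ t < 0, ∀ x, u t x = 0 :=
  Iff.rfl

/-! ## Card 1 — degenerate-stabiliser zoom -/

/-- **L1.1 (small past ⇒ zero; the small-constant Liouville in 𝒜_C).** If the scale-invariant size
`√(−t)‖u(t)‖_∞` tends to `0` as `t → −∞`, the Oseen–Duhamel estimate
`√(−t)‖u(t)‖_∞ ≤ c · (sup_{τ≤t} √(−τ)‖u(τ)‖_∞)²` (kernel bound (14) of Koch–Tataru, `∫_{−∞}^t (t−τ)^{-1/2}(−τ)^{-1} dτ = π/√(−t)`)
forces `u ≡ 0` on some `(−∞, T₁]`, and forward uniqueness of bounded mild solutions gives `u ≡ 0`. -/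
def PastSmallnessLiouville : Prop :=
  ∀ (C : ℝ) (u : ℝ → ℝ³ → ℝ³), InA C u →
    (∀ ε > 0, ∃ T < 0, ∀ t < T, ∀ x, Real.sqrt (-t) * ‖u t x‖ ≤ ε) →
    ∀ t < 0, ∀ x, u t x = 0

/-- **L1.2 (blow-down kills a period).** A spatially periodic element of 𝒜_C is small in the past:
the blow-downs `λ u(λ²t, X + λx)`, `λ → ∞`, stay in 𝒜_C, have period `p/λ → 0`, hence every local limit is
invariant under all translations along `p` and vanishes by the 2.5-D Liouville theorem (KNSS 2009 Thm 5.1 +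
caloric Liouville); compactness (KNSS §4 derivative bounds) turns this into uniform smallness. -/
def BlowdownKillsPeriod : Prop :=
  ∀ (C : ℝ) (u : ℝ → ℝ³ → ℝ³) (p : ℝ³), p ≠ 0 → InA C u →
    (∀ t < 0, ∀ x, u t (x + p) = u t x) →
    ∀ ε > 0, ∃ T < 0, ∀ t < T, ∀ x, Real.sqrt (-t) * ‖u t x‖ ≤ ε

/-- **L1.3 (periodic elements of 𝒜_C vanish)** = L1.2 + L1.1. -/
def PeriodicVanishing : Prop :=
  ∀ (C : ℝ) (u : ℝ → ℝ³ → ℝ³) (p : ℝ³), p ≠ 0 → InA C u →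
    (∀ t < 0, ∀ x, u t (x + p) = u t x) → ∀ t < 0, ∀ x, u t x = 0

/-- **L1.4 (the screw leaf of the crux: translations and helical screw motions, σ = 0).** If the
infinitesimal symmetry is `ξ = (a, 0, A)` with `A` skew and `a` NOT orthogonal to `ker A` (for `A = 0`: any
`a ≠ 0`; for `A ≠ 0`: nonzero pitch), then integrating the generator gives `u(t, S_θ x) = e^{θA} u(t,x)` for the
screw motion `S_θ`, and `θ = 2π/ω` exhibits a nonzero spatial period; conclude by L1.3. This is exactly the
`σ = 0, pitch ≠ 0` sub-case of `SymmetricLiouville` (the open "helical" leaf) plus the known translation leaf. -/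
def ScrewLeaf : Prop :=
  ∀ (C : ℝ) (u : ℝ → ℝ³ → ℝ³), InA C u →
    ∀ (a e : ℝ³) (A : ℝ³ →L[ℝ] ℝ³), (∀ x, inner ℝ (A x) x = 0) → A e = 0 → inner ℝ a e ≠ 0 →
      (∀ t < 0, ∀ x, fderiv ℝ (u t) x (a + A x) - A (u t x) = 0) →
      ∀ t < 0, ∀ x, u t x = 0

/-- **L1.5 (spiral scalings: the profile of a (rotated) self-similar element of 𝒜_C decays).** For
`ξ = (0, σ, A)`, `σ ≠ 0`: zooming at `(x₀, 0)`, `x₀ ≠ 0`, conjugates the generator to the translation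
`(σ x₀ + A x₀)·∇ ≠ 0`, so all tangent flows at off-origin points of the final time vanish; uniformly on
`1 ≤ ‖x₀‖ ≤ 2` this is smallness of `√(−t)‖u‖` outside every parabola `‖x‖ ≥ R√(−t)`, i.e. the RSS profile
`U(y) → 0` as `‖y‖ → ∞` (Pineau–Vicol's profile, arXiv:2607.09619 (1.7)). -/
def SpiralScalingDecay : Prop :=
  ∀ (C : ℝ) (u : ℝ → ℝ³ → ℝ³), InA C u →
    ∀ (σ : ℝ) (A : ℝ³ →L[ℝ] ℝ³), σ ≠ 0 → (∀ x, inner ℝ (A x) x = 0) →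
      (∀ t < 0, ∀ x, fderiv ℝ (u t) x (σ • x + A x) + σ • u t x +
        (2 * σ * t) • Literature.Analysis.FluidPDE.timeDeriv u t x - A (u t x) = 0) →
      ∀ ε > 0, ∃ R : ℝ, ∀ t < 0, ∀ x, R * Real.sqrt (-t) ≤ ‖x‖ → Real.sqrt (-t) * ‖u t x‖ ≤ ε

/-- **L1.6 (decay upgrade: Type-I vorticity ε-regularity + Biot–Savart with a point core).** Under the
hypotheses of L1.5 the solution obeys the SPACE–TIME Type-I bound `‖u(t,x)‖ ≤ C'/(‖x‖ + √(−t))`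
(in-tree `HasTypeIDecay` = Pineau–Vicol (1.10) = Conj 1.1's (1.9)), i.e. the bounded-profile RSS leaf lands in
the class of Pineau–Vicol 2026 Thm 1.4 / Conjecture 1.1. -/
def SpiralScalingTypeIDecay : Prop :=
  ∀ (C : ℝ) (u : ℝ → ℝ³ → ℝ³), InA C u →
    ∀ (σ : ℝ) (A : ℝ³ →L[ℝ] ℝ³), σ ≠ 0 → (∀ x, inner ℝ (A x) x = 0) →
      (∀ t < 0, ∀ x, fderiv ℝ (u t) x (σ • x + A x) + σ • u t x +
        (2 * σ * t) • Literature.Analysis.FluidPDE.timeDeriv u t x - A (u t x) = 0) →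
      ∃ C' : ℝ, Literature.Analysis.FluidPDE.HasTypeIDecay C' u

/-- **L1.7 (axisymmetric far field, qualitative).** For the pure-rotation leaf (pitch 0) the same zoom at
points with `r/√(−t) → ∞` degenerates the rotation to a translation along `e_θ`: `√(−t)‖u‖ → 0` away from the
axis in parabolic units. (Input to the swirl leaf, see Card 3.) -/
def AxisymmetricFarFieldSmall : Prop :=
  ∀ (C : ℝ) (u : ℝ → ℝ³ → ℝ³), InA C u →
    (∀ t < 0, Literature.Analysis.FluidPDE.IsAxisymmetric (u t)) →
      ∀ ε > 0, ∃ R : ℝ, ∀ t < 0, ∀ x, R * Real.sqrt (-t) ≤ Literature.Analysis.FluidPDE.cylRadius x →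
        Real.sqrt (-t) * ‖u t x‖ ≤ ε

/-! ## Card 3 — swirl barrier from the infinite past -/

/-- **L3.1 (the scale-invariant swirl of an axisymmetric element of 𝒜_C is bounded by `2C²`).**
`ψ_s(t,x) = (C/√(−s)) (r + 2C(√(−s) − √(−t)))` is a supersolution of the swirl equation
`Γ_t + u·∇Γ + (2/r)Γ_r = ΔΓ` on `[s, 0) × ℝ³` (only `|u_r| ≤ C/√(−t)` is used), dominates `Γ = r u_θ` at `t = s`
and on the axis; letting `s → −∞` gives `|Γ| ≤ 2C²`, i.e. `|u_θ| ≤ 2C²/r` — the swirl half of KNSS Thm 5.3's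
hypothesis `|u| ≤ C/|x'|`, for free. -/
def SwirlBarrier : Prop :=
  ∀ (C : ℝ) (u : ℝ → ℝ³ → ℝ³), InA C u →
    (∀ t < 0, Literature.Analysis.FluidPDE.IsAxisymmetric (u t)) →
      ∀ t < 0, ∀ x, |Literature.Analysis.FluidPDE.swirl (u t) x| ≤ 2 * C ^ 2

/-- **L3.2 (the pitch-0 leaf from the C/r law).** If an axisymmetric element of 𝒜_C obeys `r‖u‖ ≤ K`, it
vanishes: on every window `(−∞, −δ)` it is a bounded weak solution and KNSS 2009 Thm 5.3
(`Literature.Analysis.FluidPDE.KNSS2009_liouville_bound_C_over_r`, in-tree named fact with proved assembly) applies. -/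
def AxisymmetricLeafOfCOverR : Prop :=
  ∀ (C : ℝ) (u : ℝ → ℝ³ → ℝ³), InA C u →
    (∀ t < 0, Literature.Analysis.FluidPDE.IsAxisymmetric (u t)) →
      (∃ K : ℝ, ∀ t < 0, ∀ x, Literature.Analysis.FluidPDE.cylRadius x * ‖u t x‖ ≤ K) →
      ∀ t < 0, ∀ x, u t x = 0

/-! ## Card 2 — spiral Fokker–Planck weight + Killing pairing (RSS, Pineau–Vicol frame) -/

/-- The rotation generator about `e₃`: `J y = (−y₁, y₀, 0)` (Pineau–Vicol (1.6)). -/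
def Jrot (y : ℝ³) : ℝ³ := WithLp.toLp 2 ![-(y 1), y 0, 0]

/-- **L2.1 (the exact enstrophy / axial-vorticity identity).** Let `U` be a smooth RSS profile with rotation
rate `α` (Pineau–Vicol (1.8a): `α(JU − (Jy·∇)U) + ½U + ½(y·∇)U − ΔU + (U·∇)U + ∇P = 0`, `div U = 0`) with the
decay (1.9)/(2.1)/(2.2), and let `w > 0` solve the ADJOINT equation of the FULL spiral operator
`L_α = −Δ + (U + ½y − αJy)·∇`, i.e. `Δw + (U + ½y − αJy)·∇w + (3/2)w = 0`, with Gaussian bounds on `w, ∇w`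
(Pineau–Vicol Prop 5.1 adapted: the extra drift `αJy` is divergence free, tangent to spheres and kills radial
barriers). Then pairing the Bernoulli equation `L_α Π = −|Ω|² − α ∂_θ P` and the `e₃`-angular-momentum equation
(momentum ⋅ `Jy`) against `w` gives `∫ |Ω|² w = 2α ∫ Ω₃ w`. -/
def SpiralWeightIdentity : Prop :=
  ∀ (α : ℝ) (U : ℝ³ → ℝ³) (P w : ℝ³ → ℝ),
    ContDiff ℝ 3 U → ContDiff ℝ 2 P → ContDiff ℝ 2 w →
    Literature.Analysis.FluidPDE.VectorCalculus.IsDivFree U →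
    (∀ y, α • (Jrot (U y) - fderiv ℝ U y (Jrot y)) + (1 / 2 : ℝ) • U y + (1 / 2 : ℝ) • fderiv ℝ U y y
        - Laplacian.laplacian U y + fderiv ℝ U y (U y) + gradient P y = 0) →
    (∀ y, Laplacian.laplacian w y + fderiv ℝ w y (U y + (1 / 2 : ℝ) • y - α • Jrot y) + (3 / 2 : ℝ) * w y = 0) →
    (∀ y, 0 < w y) →
    (∃ K : ℝ, ∀ y, ‖U y‖ ≤ K / (1 + ‖y‖) ∧ ‖fderiv ℝ U y‖ ≤ K / (1 + ‖y‖ ^ 2) ∧ |P y| ≤ K ∧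
        ‖gradient P y‖ ≤ K ∧ w y ≤ K * Real.exp (-‖y‖ ^ 2 / 8) ∧ ‖fderiv ℝ w y‖ ≤ K * Real.exp (-‖y‖ ^ 2 / 8)) →
    ∫ y, ‖Literature.Analysis.FluidPDE.curl U y‖ ^ 2 * w y =
      2 * α * ∫ y, (Literature.Analysis.FluidPDE.curl U y) 2 * w y

/-- **L2.2 (consequence: enstrophy ceiling, used with Pineau–Vicol Prop 3.1).** Cauchy–Schwarz in L2.1:
`∫ |Ω|² w ≤ 4 α² ∫ w`. -/
def SpiralWeightEnstrophyCeiling : Prop :=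
  ∀ (α : ℝ) (U : ℝ³ → ℝ³) (w : ℝ³ → ℝ),
    (∀ y, 0 ≤ w y) → Integrable w →
    Integrable (fun y => ‖Literature.Analysis.FluidPDE.curl U y‖ ^ 2 * w y) →
    (∫ y, ‖Literature.Analysis.FluidPDE.curl U y‖ ^ 2 * w y =
      2 * α * ∫ y, (Literature.Analysis.FluidPDE.curl U y) 2 * w y) →
    ∫ y, ‖Literature.Analysis.FluidPDE.curl U y‖ ^ 2 * w y ≤ 4 * α ^ 2 * ∫ y, w y

end Summit.NavierStokesRegularity.NavierStokesRegularity.Cruxes.SymmetricLiouville.SketchIdeator1
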